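import Mathlib
import Literature.NumberTheory.LFunctions.Zhang2022.Section14Prop141Twisted
import Literature.NumberTheory.LFunctions.Zhang2022.Section14Eq146W
import Literature.NumberTheory.LFunctions.Zhang2022.Section14MeanSquareLowerBound
import Literature.NumberTheory.LFunctions.Zhang2022.ToolkitDivisorMajorants
import HarnessLib

/-!
# Zhang (2022) §14, (14.6): the large-conductor leg (`D³ ≤ r ≤ 2D₂P₄`) at the modulus `D₂k` from the
# lane's generic CORE-large engine — `leg2₂` of `eq146W_of_legs`, kernel-checked

Topic `Literature/NumberTheory/LFunctions/Zhang2022` (Landau–Siegel audit tree; verdict-neutral).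
Y. Zhang, *Discrete mean estimates and the Landau–Siegel zero*, arXiv:2211.02515v1 (2022)
[Zhang2022LandauSiegel] — **an unrefereed manuscript under adjudication**; nothing here asserts or
denies its Theorems 1–2 or Proposition 14.1. ZHANG-L discharge lane, WP14, helper under the leaf
`Skeleton.Prop141` (node `Z22:(14.6)`; rows G-adj2-4, G-L3t7-1; WP14-PLAN v1.1 §2.1 node «leg2₂»).

(14.6) is "similar" to (14.5) (p. 79, tex L3966–L3969); its proof splits the conductor range as (14.8)
does: "for `D³ ≤ r < 2DP₄` we use the Mellin transform, Lemma 5.4 (i) and the large sieve inequality"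
(p. 79, tex L3962–L3963). The lane proves that sentence ONCE as a coefficient-, weight- and modulus-generic
estimate — **CORE-large** (WP14-PLAN §2.2, Sketch `legSum_large_le`; owner zl-libA-p5, built on
`BErrorChain.dyadic_block_bound_frakSGen` etc.): for `1 ≤ N ≤ D`, `|c(l)| ≤ M·τ₅(l)`, `|w(p)| ≤ W`,
and any `r`-range `S ⊆ [D³, 2NP₄]`,
`Σ_{r∈S} Σ_{h<P/r} N/(φ(hr)h√r) Σ*_{θ≠χ} ‖Σ_{(l,h)=1} c(l)θ(l) Σ_{p∼P} χθ̄(p)w(p)Δ(l/(phr))‖ ≤ C·M·W·𝓛ᵏ·P²·D^{−c}`.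
This THEOREM-ONLY file derives from that statement (taken as an explicit hypothesis, in the Sketch
shape, so that it applies to the engine the moment it lands, by `fun h => eq146leg2_of_core h`) the
hypothesis `hleg2` of `Typed.Sec14.eq146W_of_legs` (`Section14Eq146W`): the (14.6) instance `N = D₂`,
`c = κ*(D₁d·)` with `M = B·τ₅(D₁d) ≤ B·τ₅(D₁)τ₅(d)` (τ₅ submultiplicative, `ToolkitDivisorMajorants`),
`w = (pt₀)^β` with `W = e^{15π}` (`norm_wt_le`), the `h`-divisibility filter dropped (non-negative
terms), then `Σ_{d≤2P₄} τ₅(d)/d ≤ 32𝓛⁴⁵`, `τ₅(D₁) ≤ C_τ D^{c/2}` (divisor bound) and `𝓛^{k+45} ≤ D^{c/4}`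
eventually, giving `≤ C'·P²·D^{−c/4}`. No Assumption (A) is used beyond passing it on.

* `exists_ell_pow_le_rpow` — `𝓛^K ≤ D^δ` for all large `D` (`δ > 0`).
* `eq146leg2_of_core` — CORE-large ⇒ `leg2₂`; `eq146W_of_leg1_of_core` — `leg1₂` ∧ CORE-large ⇒ W-146
  (composition with `eq146W_of_legs`, which also certifies that the shapes match).

## References

* Y. Zhang, arXiv:2211.02515v1 (2022), §14 pp. 78–79: (14.6), (14.8) proof, u017, tex L3915,
  L3956–L3969. [cite: Zhang2022LandauSiegel, §14 (14.6), (14.8) pp.78–79]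
-/

noncomputable section

open Complex Real ComplexConjugate

namespace Literature.NumberTheory.LFunctions.Zhang2022.Typed.Sec14

open Skeleton DirichletCharacter

/-! ## `𝓛^K ≤ D^δ` eventually -/

/-- **`𝓛^K ≤ D^δ` for all large `D`** (`δ > 0`; `log^K = o(D^δ)`), `𝓛 = log D` as in §2 (2.6).
[cite: Zhang2022LandauSiegel, §2 (2.6) p.4] -/
theorem exists_ell_pow_le_rpow (K : ℕ) {δ : ℝ} (hδ : 0 < δ) :
    ∃ D₁ : ℕ, ∀ D : ℕ, D₁ ≤ D → ell D ^ K ≤ (D : ℝ) ^ δ := by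
  have h := (isLittleO_log_rpow_rpow_atTop (K : ℝ) hδ).bound (show (0 : ℝ) < 1 by norm_num)
  have h2 : ∀ᶠ D : ℕ in Filter.atTop, ‖Real.log (D : ℝ) ^ (K : ℝ)‖ ≤ 1 * ‖(D : ℝ) ^ δ‖ :=
    tendsto_natCast_atTop_atTop.eventually h
  obtain ⟨D₁, hD₁⟩ := Filter.eventually_atTop.mp h2
  refine ⟨D₁, fun D hD => ?_⟩
  have h3 := hD₁ D hD
  rw [one_mul, Real.norm_eq_abs, Real.norm_eq_abs,
    abs_of_nonneg (Real.rpow_nonneg (Nat.cast_nonneg D) _), Real.rpow_natCast] at h3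
  rw [ell]
  exact (le_abs_self _).trans h3

/-! ## The (14.6) large-conductor leg from CORE-large -/

/-- Under (14.1), `|κ*(m)| ≤ B·τ₅(m)` with the tree's `MeanSquareMajorant.tau 5`. [cite: Zhang2022LandauSiegel, §14 (14.1) p.76] -/
theorem norm_le_tau_of_eq141 {B : ℝ} {κs : ℕ → ℂ} (hκ : Eq141 B κs) (m : ℕ) :
    ‖κs m‖ ≤ B * MeanSquareMajorant.tau 5 m := by
  have h := hκ m
  rwa [MeanSquareMajorant.tau_eq_natCoe_pow 5, ArithmeticFunction.natCoe_apply]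

/-- **`leg2₂` of `eq146W_of_legs` from the generic large-conductor engine** (WP14-PLAN Sketch
`legSum_large_le`, stated inline as the hypothesis): instance `N = D₂`, `c = κ*(D₁d·)`,
`M = B·τ₅(D₁d)`, `w = (pt₀)^β`, `W = e^{15π}`, `S = {D³ ≤ r ≤ 2D₂P₄}`; the `h`-filter `D₂/(D₂,r) ∣ h`
is dropped, `Σ_{d≤2P₄} τ₅(D₁d)/d ≤ τ₅(D₁)·32𝓛⁴⁵ ≤ 32C_τD^{c/2}𝓛⁴⁵`, `𝓛^{k+45} ≤ D^{c/4}`; output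
`≤ 32|C|·B·e^{15π}·C_τ·P²·D^{−c/4}`. [cite: Zhang2022LandauSiegel, §14 (14.6) proof p.79, tex L3962–L3969] -/
theorem eq146leg2_of_core
    (hcore : ∃ c : ℝ, 0 < c ∧ ∃ k : ℕ, ∃ C : ℝ, ForAllLarge fun D _ χ => AssumptionA D χ →
      ∀ (N : ℕ) (M W : ℝ) (w cf : ℕ → ℂ), 0 ≤ M → 0 ≤ W → 1 ≤ N → N ≤ D →
        (∀ l : ℕ, ‖cf l‖ ≤ M * MeanSquareMajorant.tau 5 l) →
        (∀ p ∈ primeWindow D, ‖w p‖ ≤ W) →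
        ∀ S : Finset ℕ, (∀ r ∈ S, D ^ 3 ≤ r ∧ (r : ℝ) ≤ 2 * N * P4 D) →
          ∑ r ∈ S, ∑ h ∈ Finset.Ico 1 ⌈bigP D / r⌉₊,
              (N : ℝ) / ((Nat.totient (h * r) : ℝ) * h * Real.sqrt r) *
                ∑ θ ∈ finsetOf {θ : DirichletCharacter ℂ r | θ.IsPrimitive ∧
                    changeLevel (dvd_mul_left r D) θ ≠ changeLevel (dvd_mul_right D r) χ},
                  ‖∑' l : ℕ, if Nat.Coprime l h then
                      cf l * θ (l : ZMod r) *
                        ∑ p ∈ primeWindow D, χ (p : ZMod D) * θ⁻¹ (p : ZMod r) * w p *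
                          DeltaW D ((l : ℝ) / ((p : ℝ) * h * r)) else 0‖
            ≤ C * M * W * ell D ^ k * bigP D ^ 2 * (D : ℝ) ^ (-c)) :
    ∀ B : ℝ, ∃ c : ℝ, 0 < c ∧ ∃ C : ℝ, ForAllLarge fun D _ χ => AssumptionA D χ →
      ∀ β : ℂ, ‖β‖ < 5 * alpha D → ∀ κs as : ℕ → ℂ, Eq141 B κs → Eq142 D B as →
        ∀ D₁ D₂ : ℕ, D₁ * D₂ = D → 1 < D₁ →
          ∑ d ∈ Finset.Icc 1 ⌊2 * P4 D⌋₊, (d : ℝ)⁻¹ *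
            ∑ r ∈ (Finset.Icc 2 ⌊2 * (D₂ : ℝ) * P4 D⌋₊).filter (fun r => ¬ r < D ^ 3),
              ∑ h ∈ (Finset.Ico 1 ⌈bigP D / r⌉₊).filter (fun h => D₂ / Nat.gcd D₂ r ∣ h),
                (D₂ : ℝ) / ((Nat.totient (h * r) : ℝ) * h * Real.sqrt r) *
                  ∑ θ' ∈ finsetOf {θ' : DirichletCharacter ℂ r | θ'.IsPrimitive ∧
                      changeLevel (dvd_mul_left r D) θ' ≠ changeLevel (dvd_mul_right D r) χ},
                    ‖∑' l : ℕ, if Nat.Coprime l h then κs (D₁ * d * l) * θ' (l : ZMod r) *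
                        ∑ p ∈ primeWindow D, χ (p : ZMod D) * θ'⁻¹ (p : ZMod r) * wt D β p *
                          DeltaW D ((l : ℝ) / ((p : ℝ) * h * r)) else 0‖
          ≤ C * bigP D ^ 2 * (D : ℝ) ^ (-c) := by
  intro B
  obtain ⟨c, hc, k, C, Dc, hC⟩ := hcore
  obtain ⟨Cτ, hCτ1, hCτ⟩ := MeanSquareMajorant.exists_tau_le_mul_rpow 5 (half_pos hc)
  obtain ⟨Dl, hDl⟩ := exists_ell_pow_le_rpow (k + 45) (show (0 : ℝ) < c / 4 by linarith)
  obtain ⟨D₃, hD₃⟩ := exists_nat_forall_le_ell 3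
  obtain ⟨Dp, hDp⟩ := exists_two_mul_P4_le_bigP
  set W : ℝ := Real.exp (15 * π) with hW_def
  have hW0 : 0 ≤ W := (Real.exp_pos _).le
  refine ⟨c / 4, by linarith, 32 * |C| * |B| * W * Cτ, ?_⟩
  refine ⟨max (max Dc Dl) (max D₃ Dp), fun D _ χ hD hq hprim hA β hβ κs as h141 h142 D₁ D₂ hD₁₂ hD₁ => ?_⟩
  have hDc : Dc ≤ D := le_trans (le_trans (le_max_left _ _) (le_max_left _ _)) hD
  have hDl' : Dl ≤ D := le_trans (le_trans (le_max_right _ _) (le_max_left _ _)) hD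
  have hD₃' : D₃ ≤ D := le_trans (le_trans (le_max_left _ _) (le_max_right _ _)) hD
  have hDp' : Dp ≤ D := le_trans (le_trans (le_max_right _ _) (le_max_right _ _)) hD
  have hℓ3 : 3 ≤ ell D := hD₃ D hD₃'
  have hℓ1 : 1 ≤ ell D := by linarith
  have hDne : D ≠ 0 := NeZero.ne D
  have hD0 : (0 : ℝ) < D := by exact_mod_cast Nat.pos_of_ne_zero hDne
  have hD1 : (1 : ℝ) ≤ D := by exact_mod_cast Nat.pos_of_ne_zero hDne
  have hB0 : 0 ≤ B := (norm_nonneg _).trans (h142.1 0)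
  have hD₂1 : 1 ≤ D₂ := Nat.pos_of_ne_zero fun h => by subst h; simp at hD₁₂; exact hDne hD₁₂.symm
  have hD₂D : D₂ ≤ D := by
    calc D₂ = 1 * D₂ := (one_mul _).symm
      _ ≤ D₁ * D₂ := Nat.mul_le_mul_right _ (by omega)
      _ = D := hD₁₂
  have hD₁D : (D₁ : ℝ) ≤ D := by
    have : D₁ ≤ D := by
      calc D₁ = D₁ * 1 := (mul_one _).symm
        _ ≤ D₁ * D₂ := Nat.mul_le_mul_left _ hD₂1
        _ = D := hD₁₂
    exact_mod_cast this
  have hP0 : 0 < bigP D := Real.exp_pos _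
  have hP4 : 0 ≤ P4 D := by
    rw [P4, t0]
    exact mul_nonneg (div_nonneg hP0.le (pow_nonneg (Real.exp_pos _).le 2))
      (pow_nonneg (Real.log_natCast_nonneg D) 519)
  -- the weight
  have hw : ∀ p ∈ primeWindow D, ‖wt D β p‖ ≤ W := fun p hp => norm_wt_le hℓ3 hp hβ.le
  -- the `r`-range
  set S : Finset ℕ := (Finset.Icc 2 ⌊2 * (D₂ : ℝ) * P4 D⌋₊).filter (fun r => ¬ r < D ^ 3) with hS_def
  have hS : ∀ r ∈ S, D ^ 3 ≤ r ∧ (r : ℝ) ≤ 2 * D₂ * P4 D := by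
    intro r hr
    obtain ⟨hr1, hr2⟩ := Finset.mem_filter.mp hr
    refine ⟨not_lt.mp hr2, ?_⟩
    have h2 := (Finset.mem_Icc.mp hr1).2
    have h0 : 0 ≤ 2 * (D₂ : ℝ) * P4 D := by positivity
    calc (r : ℝ) ≤ ⌊2 * (D₂ : ℝ) * P4 D⌋₊ := by exact_mod_cast h2
      _ ≤ 2 * (D₂ : ℝ) * P4 D := Nat.floor_le h0
  have hCore := hC D χ hDc hq hprim hA
  -- the main constant per `D`
  set K₀ : ℝ := |C| * |B| * W * ell D ^ k * bigP D ^ 2 * (D : ℝ) ^ (-c) with hK₀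
  have hK₀0 : 0 ≤ K₀ := by rw [hK₀]; positivity
  -- per `d`: the engine at `N = D₂`, `cf = κ*(D₁d·)`, `M = B·τ₅(D₁d)`
  have hper : ∀ d ∈ Finset.Icc 1 ⌊2 * P4 D⌋₊,
        ∑ r ∈ S, ∑ h ∈ (Finset.Ico 1 ⌈bigP D / r⌉₊).filter (fun h => D₂ / Nat.gcd D₂ r ∣ h),
            (D₂ : ℝ) / ((Nat.totient (h * r) : ℝ) * h * Real.sqrt r) *
              ∑ θ ∈ finsetOf {θ : DirichletCharacter ℂ r | θ.IsPrimitive ∧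
                  changeLevel (dvd_mul_left r D) θ ≠ changeLevel (dvd_mul_right D r) χ},
                ‖∑' l : ℕ, if Nat.Coprime l h then
                    (fun l => κs (D₁ * d * l)) l * θ (l : ZMod r) *
                      ∑ p ∈ primeWindow D, χ (p : ZMod D) * θ⁻¹ (p : ZMod r) * wt D β p *
                        DeltaW D ((l : ℝ) / ((p : ℝ) * h * r)) else 0‖
        ≤ K₀ * (MeanSquareMajorant.tau 5 D₁ * MeanSquareMajorant.tau 5 d) := by
    intro d hd
    set M : ℝ := B * MeanSquareMajorant.tau 5 (D₁ * d) with hM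
    have hM0 : 0 ≤ M := mul_nonneg hB0 (MeanSquareMajorant.tau_nonneg _ _)
    have hcf : ∀ l : ℕ, ‖(fun l => κs (D₁ * d * l)) l‖ ≤ M * MeanSquareMajorant.tau 5 l := by
      intro l
      calc ‖κs (D₁ * d * l)‖ ≤ B * MeanSquareMajorant.tau 5 (D₁ * d * l) := norm_le_tau_of_eq141 h141 _
        _ ≤ B * (MeanSquareMajorant.tau 5 (D₁ * d) * MeanSquareMajorant.tau 5 l) :=
            mul_le_mul_of_nonneg_left (MeanSquareMajorant.tau_mul_le 5 _ _) hB0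
        _ = M * MeanSquareMajorant.tau 5 l := by rw [hM]; ring
    have hleg := hCore D₂ M W (wt D β) (fun l => κs (D₁ * d * l)) hM0 hW0 hD₂1 hD₂D hcf hw S hS
    -- drop the `h`-filter
    have hdrop :
        ∑ r ∈ S, ∑ h ∈ (Finset.Ico 1 ⌈bigP D / r⌉₊).filter (fun h => D₂ / Nat.gcd D₂ r ∣ h),
            (D₂ : ℝ) / ((Nat.totient (h * r) : ℝ) * h * Real.sqrt r) *
              ∑ θ ∈ finsetOf {θ : DirichletCharacter ℂ r | θ.IsPrimitive ∧
                  changeLevel (dvd_mul_left r D) θ ≠ changeLevel (dvd_mul_right D r) χ},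
                ‖∑' l : ℕ, if Nat.Coprime l h then
                    (fun l => κs (D₁ * d * l)) l * θ (l : ZMod r) *
                      ∑ p ∈ primeWindow D, χ (p : ZMod D) * θ⁻¹ (p : ZMod r) * wt D β p *
                        DeltaW D ((l : ℝ) / ((p : ℝ) * h * r)) else 0‖ ≤
        ∑ r ∈ S, ∑ h ∈ Finset.Ico 1 ⌈bigP D / r⌉₊,
            (D₂ : ℝ) / ((Nat.totient (h * r) : ℝ) * h * Real.sqrt r) *
              ∑ θ ∈ finsetOf {θ : DirichletCharacter ℂ r | θ.IsPrimitive ∧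
                  changeLevel (dvd_mul_left r D) θ ≠ changeLevel (dvd_mul_right D r) χ},
                ‖∑' l : ℕ, if Nat.Coprime l h then
                    (fun l => κs (D₁ * d * l)) l * θ (l : ZMod r) *
                      ∑ p ∈ primeWindow D, χ (p : ZMod D) * θ⁻¹ (p : ZMod r) * wt D β p *
                        DeltaW D ((l : ℝ) / ((p : ℝ) * h * r)) else 0‖ := by
      refine Finset.sum_le_sum fun r _ => ?_
      refine Finset.sum_le_sum_of_subset_of_nonneg (Finset.filter_subset _ _) fun h _ _ => ?_
      exact mul_nonneg (div_nonneg (Nat.cast_nonneg _) (by positivity))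
        (Finset.sum_nonneg fun θ _ => norm_nonneg _)
    refine hdrop.trans (hleg.trans ?_)
    -- `C·M·W·𝓛ᵏ·P²·D^{-c} ≤ K₀·τ₅(D₁)·τ₅(d)`
    have hτsplit : MeanSquareMajorant.tau 5 (D₁ * d) ≤
        MeanSquareMajorant.tau 5 D₁ * MeanSquareMajorant.tau 5 d := MeanSquareMajorant.tau_mul_le 5 _ _
    have hrest : 0 ≤ W * ell D ^ k * bigP D ^ 2 * (D : ℝ) ^ (-c) := by positivity
    calc C * M * W * ell D ^ k * bigP D ^ 2 * (D : ℝ) ^ (-c)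
        ≤ |C| * M * W * ell D ^ k * bigP D ^ 2 * (D : ℝ) ^ (-c) := by
          have : C * M ≤ |C| * M := mul_le_mul_of_nonneg_right (le_abs_self C) hM0
          have h2 : C * M * (W * ell D ^ k * bigP D ^ 2 * (D : ℝ) ^ (-c)) ≤
              |C| * M * (W * ell D ^ k * bigP D ^ 2 * (D : ℝ) ^ (-c)) :=
            mul_le_mul_of_nonneg_right this hrest
          linarith [h2]
      _ = (|C| * W * ell D ^ k * bigP D ^ 2 * (D : ℝ) ^ (-c)) * (B * MeanSquareMajorant.tau 5 (D₁ * d)) := by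
          rw [hM]; ring
      _ ≤ (|C| * W * ell D ^ k * bigP D ^ 2 * (D : ℝ) ^ (-c)) *
            (|B| * (MeanSquareMajorant.tau 5 D₁ * MeanSquareMajorant.tau 5 d)) := by
          refine mul_le_mul_of_nonneg_left ?_ (by positivity)
          exact mul_le_mul (le_abs_self B) hτsplit (MeanSquareMajorant.tau_nonneg _ _) (abs_nonneg B)
      _ = K₀ * (MeanSquareMajorant.tau 5 D₁ * MeanSquareMajorant.tau 5 d) := by rw [hK₀]; ring
  -- sum over `d`
  have hdsum : ∑ d ∈ Finset.Icc 1 ⌊2 * P4 D⌋₊, MeanSquareMajorant.tau 5 d / d ≤ 32 * ell D ^ 45 := by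
    refine (MeanSquareMajorant.sum_tau_div_Icc_le_log_pow 5 ⌊2 * P4 D⌋₊).trans ?_
    have hlogK : Real.log (⌊2 * P4 D⌋₊ : ℕ) ≤ ell D ^ 9 := by
      have hlogP : Real.log (bigP D) = ell D ^ 9 := by rw [bigP, Real.log_exp]
      rcases Nat.eq_zero_or_pos ⌊2 * P4 D⌋₊ with h0 | hpos
      · rw [h0, Nat.cast_zero, Real.log_zero]; positivity
      · rw [← hlogP]
        refine Real.log_le_log (by exact_mod_cast hpos) ?_
        exact (Nat.floor_le (by positivity)).trans (hDp D hDp')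
    have h9 : (1 : ℝ) ≤ ell D ^ 9 := one_le_pow₀ hℓ1
    have hlog0 : 0 ≤ Real.log (⌊2 * P4 D⌋₊ : ℕ) := Real.log_natCast_nonneg _
    calc (1 + Real.log (⌊2 * P4 D⌋₊ : ℕ)) ^ 5 ≤ (2 * ell D ^ 9) ^ 5 :=
          pow_le_pow_left₀ (by linarith) (by linarith) 5
      _ = 32 * ell D ^ 45 := by ring
  have hτD₁ : MeanSquareMajorant.tau 5 D₁ ≤ Cτ * (D : ℝ) ^ (c / 2) := by
    refine (hCτ D₁).trans (mul_le_mul_of_nonneg_left ?_ (by linarith))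
    exact Real.rpow_le_rpow (Nat.cast_nonneg _) hD₁D (by linarith)
  have hτD₁0 : 0 ≤ MeanSquareMajorant.tau 5 D₁ := MeanSquareMajorant.tau_nonneg _ _
  have hlogpow : ell D ^ (k + 45) ≤ (D : ℝ) ^ (c / 4) := hDl D hDl'
  calc
      ∑ d ∈ Finset.Icc 1 ⌊2 * P4 D⌋₊, (d : ℝ)⁻¹ *
        ∑ r ∈ (Finset.Icc 2 ⌊2 * (D₂ : ℝ) * P4 D⌋₊).filter (fun r => ¬ r < D ^ 3),
          ∑ h ∈ (Finset.Ico 1 ⌈bigP D / r⌉₊).filter (fun h => D₂ / Nat.gcd D₂ r ∣ h),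
            (D₂ : ℝ) / ((Nat.totient (h * r) : ℝ) * h * Real.sqrt r) *
              ∑ θ' ∈ finsetOf {θ' : DirichletCharacter ℂ r | θ'.IsPrimitive ∧
                  changeLevel (dvd_mul_left r D) θ' ≠ changeLevel (dvd_mul_right D r) χ},
                ‖∑' l : ℕ, if Nat.Coprime l h then κs (D₁ * d * l) * θ' (l : ZMod r) *
                    ∑ p ∈ primeWindow D, χ (p : ZMod D) * θ'⁻¹ (p : ZMod r) * wt D β p *
                      DeltaW D ((l : ℝ) / ((p : ℝ) * h * r)) else 0‖
      ≤ ∑ d ∈ Finset.Icc 1 ⌊2 * P4 D⌋₊, (d : ℝ)⁻¹ *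
          (K₀ * (MeanSquareMajorant.tau 5 D₁ * MeanSquareMajorant.tau 5 d)) := by
        refine Finset.sum_le_sum fun d hd => ?_
        exact mul_le_mul_of_nonneg_left (hper d hd) (inv_nonneg.mpr (Nat.cast_nonneg d))
    _ = K₀ * MeanSquareMajorant.tau 5 D₁ *
          ∑ d ∈ Finset.Icc 1 ⌊2 * P4 D⌋₊, MeanSquareMajorant.tau 5 d / d := by
        rw [Finset.mul_sum]
        refine Finset.sum_congr rfl fun d _ => ?_
        rw [div_eq_mul_inv]; ring
    _ ≤ K₀ * (Cτ * (D : ℝ) ^ (c / 2)) * (32 * ell D ^ 45) := by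
        have h1 : K₀ * MeanSquareMajorant.tau 5 D₁ ≤ K₀ * (Cτ * (D : ℝ) ^ (c / 2)) :=
          mul_le_mul_of_nonneg_left hτD₁ hK₀0
        have h0 : 0 ≤ ∑ d ∈ Finset.Icc 1 ⌊2 * P4 D⌋₊, MeanSquareMajorant.tau 5 d / d :=
          Finset.sum_nonneg fun d _ => div_nonneg (MeanSquareMajorant.tau_nonneg _ _) (Nat.cast_nonneg _)
        exact mul_le_mul h1 hdsum h0 (by positivity)
    _ = 32 * |C| * |B| * W * Cτ * bigP D ^ 2 *
          (ell D ^ (k + 45) * ((D : ℝ) ^ (c / 2) * (D : ℝ) ^ (-c))) := by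
        rw [hK₀, pow_add]; ring
    _ ≤ 32 * |C| * |B| * W * Cτ * bigP D ^ 2 * ((D : ℝ) ^ (c / 4) * (D : ℝ) ^ (-(c / 2))) := by
        have h1 : (D : ℝ) ^ (c / 2) * (D : ℝ) ^ (-c) = (D : ℝ) ^ (-(c / 2)) := by
          rw [← Real.rpow_add hD0]; ring_nf
        rw [h1]
        have h0 : 0 ≤ 32 * |C| * |B| * W * Cτ * bigP D ^ 2 := by
          have : 0 ≤ Cτ := by linarith
          positivity
        refine mul_le_mul_of_nonneg_left ?_ h0
        exact mul_le_mul_of_nonneg_right hlogpow (Real.rpow_nonneg hD0.le _)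
    _ = 32 * |C| * |B| * W * Cτ * bigP D ^ 2 * (D : ℝ) ^ (-(c / 4)) := by
        rw [← Real.rpow_add hD0]; ring_nf


/-! ## W-146 from `leg1₂` and CORE-large -/

/-- **W-146 ⇐ `leg1₂` ∧ CORE-large**: composing `eq146leg2_of_core` with `eq146W_of_legs`, the weighted
(14.6) — hypothesis `h146` of `prop141_of_parts` — follows from the small-conductor leg at the modulus
`D₂k` and the generic large-conductor engine. [cite: Zhang2022LandauSiegel, §14 (14.6) pp.78–79] -/
theorem eq146W_of_leg1_of_core
    (hcore : ∃ c : ℝ, 0 < c ∧ ∃ k : ℕ, ∃ C : ℝ, ForAllLarge fun D _ χ => AssumptionA D χ →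
      ∀ (N : ℕ) (M W : ℝ) (w cf : ℕ → ℂ), 0 ≤ M → 0 ≤ W → 1 ≤ N → N ≤ D →
        (∀ l : ℕ, ‖cf l‖ ≤ M * MeanSquareMajorant.tau 5 l) →
        (∀ p ∈ primeWindow D, ‖w p‖ ≤ W) →
        ∀ S : Finset ℕ, (∀ r ∈ S, D ^ 3 ≤ r ∧ (r : ℝ) ≤ 2 * N * P4 D) →
          ∑ r ∈ S, ∑ h ∈ Finset.Ico 1 ⌈bigP D / r⌉₊,
              (N : ℝ) / ((Nat.totient (h * r) : ℝ) * h * Real.sqrt r) *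
                ∑ θ ∈ finsetOf {θ : DirichletCharacter ℂ r | θ.IsPrimitive ∧
                    changeLevel (dvd_mul_left r D) θ ≠ changeLevel (dvd_mul_right D r) χ},
                  ‖∑' l : ℕ, if Nat.Coprime l h then
                      cf l * θ (l : ZMod r) *
                        ∑ p ∈ primeWindow D, χ (p : ZMod D) * θ⁻¹ (p : ZMod r) * w p *
                          DeltaW D ((l : ℝ) / ((p : ℝ) * h * r)) else 0‖
            ≤ C * M * W * ell D ^ k * bigP D ^ 2 * (D : ℝ) ^ (-c))
    (hleg1 : ∀ B : ℝ, ∃ c : ℝ, 0 < c ∧ ∃ C : ℝ, ForAllLarge fun D _ χ => AssumptionA D χ →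
      ∀ β : ℂ, ‖β‖ < 5 * alpha D → ∀ κs as : ℕ → ℂ, Eq141 B κs → Eq142 D B as →
        ∀ D₁ D₂ : ℕ, D₁ * D₂ = D → 1 < D₁ →
          ∑ d ∈ Finset.Icc 1 ⌊2 * P4 D⌋₊, (d : ℝ)⁻¹ *
            ∑ r ∈ (Finset.Icc 2 ⌊2 * (D₂ : ℝ) * P4 D⌋₊).filter (fun r => r < D ^ 3),
              ∑ h ∈ (Finset.Ico 1 ⌈bigP D / r⌉₊).filter (fun h => D₂ / Nat.gcd D₂ r ∣ h),
                (D₂ : ℝ) / ((Nat.totient (h * r) : ℝ) * h * Real.sqrt r) *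
                  ∑ θ' ∈ finsetOf {θ' : DirichletCharacter ℂ r | θ'.IsPrimitive ∧
                      changeLevel (dvd_mul_left r D) θ' ≠ changeLevel (dvd_mul_right D r) χ},
                    ‖∑' l : ℕ, if Nat.Coprime l h then κs (D₁ * d * l) * θ' (l : ZMod r) *
                        ∑ p ∈ primeWindow D, χ (p : ZMod D) * θ'⁻¹ (p : ZMod r) * wt D β p *
                          DeltaW D ((l : ℝ) / ((p : ℝ) * h * r)) else 0‖
          ≤ C * bigP D ^ 2 * (D : ℝ) ^ (-c)) :
    ∀ B : ℝ, ∃ c : ℝ, 0 < c ∧ ∃ C : ℝ, ForAllLarge fun D _ χ => AssumptionA D χ →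
      ∀ β : ℂ, ‖β‖ < 5 * alpha D → ∀ κs as : ℕ → ℂ, Eq141 B κs → Eq142 D B as →
        ∀ D₁ D₂ : ℕ, D₁ * D₂ = D → 1 < D₁ →
          ‖∑ p ∈ primeWindow D, χ (p : ZMod D) * wt D β p * calS D D₁ D₂ p κs as‖
            ≤ C * bigP D ^ 2 * (D : ℝ) ^ (1 / 2 - c) :=
  eq146W_of_legs hleg1 (eq146leg2_of_core hcore)

end Literature.NumberTheory.LFunctions.Zhang2022.Typed.Sec14
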